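import Literature.NumberTheory.Transcendental.NesterenkoEliminationLocalization
import Literature.NumberTheory.Transcendental.NesterenkoEliminationProofs
import Literature.NumberTheory.Transcendental.NesterenkoEliminationPrimeForm
import Literature.NumberTheory.Transcendental.NesterenkoChowFormHypersurface
import Mathlib.Algebra.MvPolynomial.PDeriv
import Mathlib.Algebra.MvPolynomial.NoZeroDivisors
import HarnessLib

/-!
# A homogeneous prime is determined by its `U`-eliminant ideal ("no two distinct varieties have the same Cayley form", Hodge–Pedoe X §7) — proved

Topic `Literature/NumberTheory/Transcendental`. For a homogeneous prime `𝔭 ⊂ ℚ[x₀, …, x_m]` of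
dimension `r − 1 ≥ 0` the `U`-eliminant ideal `𝔭̄(r) = elimIdeal 𝔭 r` (LNM 1752 Ch. 3 Def. 4.3;
Philippon 1986 §1) is a non-zero principal prime ideal `(F)` — in the tree:
`NesterenkoEliminationPrimeForm.lean` (`elimIdeal_ne_bot`, `isPrincipal_elimIdeal_of_isPrime`) and
`NesterenkoEliminationLocalization.lean` (`isPrime_elimIdeal`, and the generic-point description
`𝔭̄(r) = ker Φ_{j₀}`, `mem_elimIdeal_iff_Phi`). This file PROVES hypothesis `h4` of
`NesterenkoPhilippon2001_ch3_prop_4_4_of` (`NesterenkoEliminationProofs.lean`):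

* `eq_of_elimIdeal_eq` — two homogeneous primes of the same dimension `r − 1 ≥ 0` with the same
  `𝔭̄(r)` are equal (Hodge–Pedoe, *Methods of Algebraic Geometry* II, Ch. X §7: "factorisation of the
  Cayley form gives a generic point of `V` … no two distinct varieties can have the same Cayley form").

The proof recovers `𝔭` from a generator `F` of `𝔭̄(r)` through the classical derivative identities of
the Cayley form (Hodge–Pedoe X §6, eqs. (3)–(5)), derived here from `𝔭̄(r) = ker Φ_{j₀}`:

* `pderiv_Phi` (chain rule): `∂_{u_{ρσ}} Φ(G) = Φ(∂_{u_{ρσ}}G) − (ξ_σ/ξ_{j₀}) Φ(∂_{u_{ρj₀}}G)`, whence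
  for `G ∈ 𝔭̄(r)`: `ξ_{j₀} Φ(∂G/∂u_{ρσ}) = ξ_σ Φ(∂G/∂u_{ρj₀})` (`Phi_pderiv_of_Phi_eq_zero`) — the
  block-`ρ` gradient of `G` at the generic hyperplanes through the generic point `ξ` is proportional
  to `ξ`;
* hence for homogeneous `P` of degree `D`: `ξ_{j₀}^D Φ(P(∇_ρ G)) = Φ(∂G/∂u_{ρj₀})^D P(ξ)`
  (`Phi_aeval_gradU`);
* non-degeneracy `Φ(∂F/∂u_{ρj₀}) ≠ 0` (`Phi_pderiv_ne_zero`): `F` involves `u_{ρj₀}` (else, by the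
  `S_r`-symmetry of `Ī(r)` from `NesterenkoEliminationProofs.lean`, no `u_{ρ'j₀}` at all and then
  `Φ(F) ≠ 0`), so `∂F/∂u_{ρj₀} ≠ 0` (characteristic zero) has smaller `u_{ρj₀}`-degree than `F` and is
  not a multiple of `F`;
* therefore `P ∈ 𝔭 ⇔ F ∣ P(∂F/∂u_{ρ0}, …, ∂F/∂u_{ρm})` for homogeneous `P` (`mem_iff_dvd_aeval_gradU`),
  a description of the homogeneous elements of `𝔭` in terms of `F` alone; two homogeneous ideals with
  the same homogeneous elements coincide.

No new named facts; the only definition is the gradient tuple `gradU`.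

## References

* [HodgePedoe1994] W. V. D. Hodge, D. Pedoe, *Methods of Algebraic Geometry* II (CUP 1952, repr.
  1994), Ch. X §6 (eqs. (3)–(5), `∂f/∂ζ_ρ ≠ 0`), §7 (generic point from the Cayley form; "no two
  distinct varieties can have the same Cayley form").
* [NesterenkoPhilippon2001] LNM 1752 (2001), Ch. 3 (Yu. V. Nesterenko) §4, Prop. 4.4 (p. 38).
* [Philippon1986Criteres] P. Philippon, Publ. Math. IHÉS 64 (1986) §1.
-/

noncomputable section

open MvPolynomial

attribute [local instance] MvPolynomial.gradedAlgebra

namespace Literature.NumberTheory.Transcendental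

namespace Nesterenko

variable {m : ℕ}

/-! ### Two small facts about the generic point (complements to `NesterenkoEliminationLocalization.lean`) -/

section GenericPoint

variable (𝔭 : Ideal (Rx m)) [𝔭.IsPrime]

omit [𝔭.IsPrime] in
/-- `ℚ → Ω` is the structure map. [folklore] -/
theorem qΩ_apply (c : ℚ) : qΩ 𝔭 c = algebraMap ℚ (Ω 𝔭) c := by
  rw [qΩ, RingHom.comp_apply, RingHom.comp_apply, IsScalarTower.algebraMap_apply ℚ (Rx m ⧸ 𝔭) (Ω 𝔭),
    ← Ideal.Quotient.mk_algebraMap, MvPolynomial.algebraMap_eq]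

omit [𝔭.IsPrime] in
/-- The evaluation `ℚ[y] → Ω`, `y_k ↦ ξ_k`, is `ℚ[y] → ℚ[y]/𝔭 → Ω`. [folklore] -/
theorem aeval_ξ_eq (P : Rx m) :
    aeval (ξ 𝔭) P = algebraMap (Rx m ⧸ 𝔭) (Ω 𝔭) (Ideal.Quotient.mk 𝔭 P) := by
  have : (aeval (ξ 𝔭) : Rx m →ₐ[ℚ] Ω 𝔭) =
      (IsScalarTower.toAlgHom ℚ (Rx m ⧸ 𝔭) (Ω 𝔭)).comp (Ideal.Quotient.mkₐ ℚ 𝔭) := by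
    apply MvPolynomial.algHom_ext
    intro k
    simp
  exact AlgHom.congr_fun this P

omit [𝔭.IsPrime] in
/-- `P(ξ) = 0 ⇔ P ∈ 𝔭`. [folklore] -/
theorem aeval_ξ_eq_zero_iff (P : Rx m) : aeval (ξ 𝔭) P = 0 ↔ P ∈ 𝔭 := by
  rw [aeval_ξ_eq, IsFractionRing.to_map_eq_zero_iff, Ideal.Quotient.eq_zero_iff_mem]

end GenericPoint

/-! ### Derivatives of elements of `𝔭̄(r)` at the generic point, and `𝔭̄(r)` determines `𝔭` -/

section Distinct

variable (𝔭 : Ideal (Rx m)) [𝔭.IsPrime] (r : ℕ) (j₀ : Fin (m + 1))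

/-- `Φ_{j₀}` commutes with substitution of polynomials with rational coefficients:
`Φ(P(g₀, …, g_m)) = P(Φ(g₀), …, Φ(g_m))`. [folklore] -/
theorem Phi_aeval (g : Fin (m + 1) → RU r m) (P : Rx m) :
    Phi 𝔭 r j₀ (aeval g P) = aeval (fun σ => Phi 𝔭 r j₀ (g σ)) P := by
  have : (Phi 𝔭 r j₀).comp (aeval g).toRingHom =
      (aeval (R := ℚ) fun σ => Phi 𝔭 r j₀ (g σ)).toRingHom := by
    apply MvPolynomial.ringHom_ext
    · intro c
      simp only [RingHom.comp_apply, AlgHom.toRingHom_eq_coe, RingHom.coe_coe, MvPolynomial.algHom_C,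
        MvPolynomial.algebraMap_eq, MvPolynomial.algebraMap_apply]
      rw [Phi, RingHom.comp_apply, map_C, tau_C, qΩ_apply]
    · intro σ
      simp
  exact RingHom.congr_fun this P

/-- The chain rule on variables. [folklore] -/
theorem pderiv_Phi_X {ρ : Fin r} {σ : Fin (m + 1)} (hσ : σ ≠ j₀) (i : Fin r) (k : Fin (m + 1)) :
    pderiv (ρ, σ) (Phi 𝔭 r j₀ (X (i, k))) =
      Phi 𝔭 r j₀ (pderiv (ρ, σ) (X (i, k))) -
        C (ξ 𝔭 σ * (ξ 𝔭 j₀)⁻¹) * Phi 𝔭 r j₀ (pderiv (ρ, j₀) (X (i, k))) := by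
  classical
  rw [Phi, RingHom.comp_apply, map_X, tau_X]
  by_cases hk : k = j₀
  · subst hk
    rw [pderiv_X_of_ne (show (i, k) ≠ (ρ, σ) from fun h => hσ (congrArg Prod.snd h).symm), map_zero,
      zero_sub]
    by_cases hi : i = ρ
    · subst hi
      rw [pderiv_X_self, map_one, mul_one, tauU_self, Derivation.map_neg, pderiv_C_mul, map_sum,
        Finset.sum_eq_single σ]
      · rw [pderiv_C_mul, pderiv_X_self, mul_one, ← map_mul, mul_comm ((ξ 𝔭 k)⁻¹)]
      · intro k' _ hk'
        rw [pderiv_C_mul, pderiv_X_of_ne (show (i, k') ≠ (i, σ) from fun h => hk' (congrArg Prod.snd h)),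
          mul_zero]
      · intro h
        exact absurd (Finset.mem_erase.2 ⟨hσ, Finset.mem_univ σ⟩) h
    · rw [pderiv_X_of_ne (show (i, k) ≠ (ρ, k) from fun h => hi (congrArg Prod.fst h)), map_zero,
        mul_zero, neg_zero, tauU_self, Derivation.map_neg, pderiv_C_mul, map_sum, Finset.sum_eq_zero,
        mul_zero, neg_zero]
      intro k' _
      rw [pderiv_C_mul, pderiv_X_of_ne (show (i, k') ≠ (ρ, σ) from fun h => hi (congrArg Prod.fst h)),
        mul_zero]
  · rw [tauU_of_ne _ _ (show (i, k).2 ≠ j₀ from hk),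
      pderiv_X_of_ne (show (i, k) ≠ (ρ, j₀) from fun h => hk (congrArg Prod.snd h)), map_zero, mul_zero,
      sub_zero]
    by_cases h : (i, k) = (ρ, σ)
    · rw [h, pderiv_X_self, pderiv_X_self, map_one]
    · rw [pderiv_X_of_ne h, pderiv_X_of_ne h, map_zero]

/-- **The chain rule for `Φ_{j₀}`**: for `σ ≠ j₀`,
`∂_{u_{ρσ}} Φ(G) = Φ(∂_{u_{ρσ}} G) − (ξ_σ/ξ_{j₀}) Φ(∂_{u_{ρj₀}} G)` (the substituted value of
`u_{ρj₀}` is `−(1/ξ_{j₀}) ∑_{k≠j₀} ξ_k u_{ρk}`, of derivative `−ξ_σ/ξ_{j₀}` in `u_{ρσ}`).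
[cite: HodgePedoe1994, vol. II, Ch. X §6, eq. (3)–(5)] -/
theorem pderiv_Phi {ρ : Fin r} {σ : Fin (m + 1)} (hσ : σ ≠ j₀) (G : RU r m) :
    pderiv (ρ, σ) (Phi 𝔭 r j₀ G) =
      Phi 𝔭 r j₀ (pderiv (ρ, σ) G) - C (ξ 𝔭 σ * (ξ 𝔭 j₀)⁻¹) * Phi 𝔭 r j₀ (pderiv (ρ, j₀) G) := by
  classical
  induction G using MvPolynomial.induction_on with
  | C c =>
    simp only [Phi, RingHom.comp_apply, map_C, tau_C, pderiv_C, map_zero, mul_zero, sub_zero]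
  | add p q hp hq =>
    simp only [map_add, hp, hq]
    ring
  | mul_X p ik hp =>
    obtain ⟨i, k⟩ := ik
    have hX := pderiv_Phi_X 𝔭 r j₀ (ρ := ρ) hσ i k
    simp only [map_mul, Derivation.leibniz, smul_eq_mul, map_add, hp, hX]
    ring

variable {𝔭 r j₀} in
/-- For `G ∈ 𝔭̄(r)` (i.e. `Φ(G) = 0`): `ξ_{j₀} Φ(∂_{u_{ρσ}} G) = ξ_σ Φ(∂_{u_{ρj₀}} G)` — the gradient of
`G` in the block `u_ρ`, at the generic hyperplanes through `ξ`, is proportional to `ξ`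
(Hodge–Pedoe X §6, eq. (5)). [cite: HodgePedoe1994, vol. II, Ch. X §6, eq. (5)] -/
theorem Phi_pderiv_of_Phi_eq_zero (hj₀ : (X j₀ : Rx m) ∉ 𝔭) {G : RU r m} (hG : Phi 𝔭 r j₀ G = 0)
    (ρ : Fin r) (σ : Fin (m + 1)) :
    C (ξ 𝔭 j₀) * Phi 𝔭 r j₀ (pderiv (ρ, σ) G) = C (ξ 𝔭 σ) * Phi 𝔭 r j₀ (pderiv (ρ, j₀) G) := by
  by_cases hσ : σ = j₀
  · subst hσ; rfl
  · have h := pderiv_Phi 𝔭 r j₀ (ρ := ρ) hσ G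
    rw [hG, Derivation.map_zero] at h
    have h' : Phi 𝔭 r j₀ (pderiv (ρ, σ) G) =
        C (ξ 𝔭 σ * (ξ 𝔭 j₀)⁻¹) * Phi 𝔭 r j₀ (pderiv (ρ, j₀) G) := by
      rw [eq_comm, sub_eq_zero] at h
      exact h
    rw [h', ← mul_assoc, ← map_mul]
    congr 2
    rw [mul_comm, mul_assoc, inv_mul_cancel₀ (ξ_ne_zero hj₀), mul_one]

/-- The gradient `∇_ρ G = (∂G/∂u_{ρ0}, …, ∂G/∂u_{ρm})` in the block `u_ρ`. [folklore] -/
def gradU (ρ : Fin r) (G : RU r m) : Fin (m + 1) → RU r m := fun σ => pderiv (ρ, σ) G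

variable {𝔭 r j₀} in
/-- **(⋆⋆)** For `G ∈ 𝔭̄(r)` and `P` homogeneous of degree `D`:
`ξ_{j₀}^D Φ(P(∇_ρ G)) = Φ(∂G/∂u_{ρj₀})^D · P(ξ)`. [cite: HodgePedoe1994, vol. II, Ch. X §7] -/
theorem Phi_aeval_gradU (hj₀ : (X j₀ : Rx m) ∉ 𝔭) {G : RU r m} (hG : Phi 𝔭 r j₀ G = 0) (ρ : Fin r)
    {P : Rx m} {D : ℕ} (hP : P.IsHomogeneous D) :
    C (ξ 𝔭 j₀) ^ D * Phi 𝔭 r j₀ (aeval (gradU r ρ G) P) =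
      Phi 𝔭 r j₀ (pderiv (ρ, j₀) G) ^ D * C (aeval (ξ 𝔭) P) := by
  rw [Phi_aeval, ← aeval_mul_of_isHomogeneous hP]
  have hfun : (fun σ => C (ξ 𝔭 j₀) * Phi 𝔭 r j₀ (gradU r ρ G σ)) =
      fun σ => Phi 𝔭 r j₀ (pderiv (ρ, j₀) G) * C (ξ 𝔭 σ) := by
    funext σ
    rw [gradU, Phi_pderiv_of_Phi_eq_zero hj₀ hG ρ σ, mul_comm]
  rw [hfun, aeval_mul_of_isHomogeneous hP]
  congr 1
  -- `aeval (C ∘ ξ) P = C (aeval ξ P)`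
  have : (aeval (R := ℚ) fun σ => (C (ξ 𝔭 σ) : MvPolynomial (Fin r × Fin (m + 1)) (Ω 𝔭))) =
      (IsScalarTower.toAlgHom ℚ (Ω 𝔭) _).comp (aeval (ξ 𝔭)) := by
    apply MvPolynomial.algHom_ext
    intro σ
    simp
  rw [this]
  rfl

/-! #### Non-degeneracy: `Φ(∂F/∂u_{ρj₀}) ≠ 0` for a generator `F` of `𝔭̄(r)` -/

/-- In characteristic zero a polynomial involving the variable `i` has non-zero `i`-th partial
derivative. [folklore] -/
theorem pderiv_ne_zero_of_mem_vars {σ : Type*} {F : MvPolynomial σ ℚ} {i : σ} (hi : i ∈ F.vars) :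
    pderiv i F ≠ 0 := by
  classical
  rw [mem_vars_iff_mem_support] at hi
  obtain ⟨d, hd, hid⟩ := hi
  intro h0
  have hdi : 1 ≤ d i := Nat.one_le_iff_ne_zero.2 (Finsupp.mem_support_iff.1 hid)
  set d' : σ →₀ ℕ := d - Finsupp.single i 1 with hd'def
  have hd' : d' + Finsupp.single i 1 = d := by
    ext j
    rw [Finsupp.add_apply, hd'def, Finsupp.tsub_apply, Finsupp.single_apply]
    by_cases hj : i = j
    · subst hj
      rw [if_pos rfl]
      omega
    · rw [if_neg hj]
      omega
  have hc := congrArg (coeff d') h0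
  rw [coeff_pderiv, coeff_zero, hd'] at hc
  rcases mul_eq_zero.1 hc with h | h
  · exact (mem_support_iff.1 hd) h
  · have e : d' i + 1 = d i := by
      rw [hd'def, Finsupp.tsub_apply, Finsupp.single_eq_same]
      omega
    have : ((d' i : ℚ) + 1) = (d i : ℚ) := by exact_mod_cast e
    rw [this] at h
    exact (Nat.cast_ne_zero.2 (by omega : d i ≠ 0)) h

/-- `deg_{u_i} (∂F/∂u_i) < deg_{u_i} F` when the derivative is non-zero. [folklore] -/
theorem degreeOf_pderiv_lt {σ : Type*} {F : MvPolynomial σ ℚ} {i : σ} (h : pderiv i F ≠ 0) :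
    degreeOf i (pderiv i F) < degreeOf i F := by
  classical
  have hpos : 0 < degreeOf i F := by
    rw [Nat.pos_iff_ne_zero, ← mem_vars_iff_degreeOf_ne_zero]
    by_contra hi
    exact h (pderiv_eq_zero_of_notMem_vars hi)
  rw [degreeOf_lt_iff hpos]
  intro d hd
  have hc : coeff (d + Finsupp.single i 1) F ≠ 0 := by
    intro h0
    apply mem_support_iff.1 hd
    rw [coeff_pderiv, h0, zero_mul]
  have hle : d i + 1 ≤ degreeOf i F := by
    have h := Finset.le_sup (f := fun m : σ →₀ ℕ => m i) (mem_support_iff.2 hc)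
    rw [← degreeOf_eq_sup] at h
    simpa using h
  omega

/-- A non-zero polynomial does not divide its own (non-zero) partial derivative. [folklore] -/
theorem not_dvd_pderiv {σ : Type*} {F : MvPolynomial σ ℚ} {i : σ} (h : pderiv i F ≠ 0) :
    ¬ F ∣ pderiv i F := by
  rintro ⟨Q, hQ⟩
  have hF : F ≠ 0 := by rintro rfl; exact h (by simp)
  have hQ0 : Q ≠ 0 := by rintro rfl; exact h (by rw [hQ, mul_zero])
  have hlt := degreeOf_pderiv_lt h
  rw [hQ, degreeOf_mul_eq hF hQ0] at hlt
  omega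

variable {𝔭 r j₀} in
/-- If `F ∈ ℚ[U]` involves no variable `u_{ρ j₀}` (any `ρ`), then `Φ_{j₀}(F)` is `F` with
coefficients read in `Ω` (the substitution `τ_{j₀}` only touches the `u_{ρ j₀}`), hence non-zero if
`F ≠ 0`. [folklore] -/
theorem Phi_ne_zero_of_forall_notMem_vars {F : RU r m} (hF : F ≠ 0)
    (hvars : ∀ v ∈ F.vars, v.2 ≠ j₀) : Phi 𝔭 r j₀ F ≠ 0 := by
  have h : Phi 𝔭 r j₀ F = MvPolynomial.map (qΩ 𝔭) F := by
    rw [Phi, RingHom.comp_apply]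
    refine MvPolynomial.hom_congr_vars (f₂ := RingHom.id _) ?_ ?_ rfl
    · ext c
      simp
    · intro v hv _
      have hv' : v ∈ F.vars := vars_map F (qΩ 𝔭) hv
      rw [tau_X, RingHom.id_apply, tauU_of_ne _ _ (hvars v hv')]
  rw [h]
  exact fun h0 => hF (MvPolynomial.map_injective _ (qΩ 𝔭).injective (by rw [h0, map_zero]))

variable {r} in
/-- The set of variables of a generator of `Ī(r)` is stable under the block permutations `S_r`
(`Ī(r)` is `S_r`-stable, so `σ·F = c F`, `c ∈ ℚˣ`). [folklore] -/
theorem blockPerm_mem_vars_of_span_eq {I : Ideal (Rx m)} {F : RU r m}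
    (hF : Ideal.span {F} = elimIdeal I r) (σ : Equiv.Perm (Fin r)) {v : Fin r × Fin (m + 1)}
    (hv : v ∈ F.vars) : blockPerm σ v ∈ F.vars := by
  classical
  have hspan' : Ideal.span {rename (blockPerm (m := m) σ) F} = elimIdeal I r := by
    rw [← Set.image_singleton, ← Ideal.map_span, hF, map_rename_blockPerm_elimIdeal]
  have hass : Associated (rename (blockPerm (m := m) σ) F) F := by
    rw [← Ideal.span_singleton_eq_span_singleton, hF, hspan']
  obtain ⟨u, hu⟩ := hass
  obtain ⟨c, hc, hcu⟩ := (MvPolynomial.isUnit_iff_eq_C_of_isReduced).1 u.isUnit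
  have hc0 : c ≠ 0 := hc.ne_zero
  -- `vars (σ·F) = vars F`
  have hvarsEq : (rename (blockPerm (m := m) σ) F).vars = F.vars := by
    conv_rhs => rw [← hu, hcu, mul_comm, vars_C_mul c hc0]
  -- `F = σ⁻¹·(σ·F)`, so `v = σ⁻¹ w` for some `w ∈ vars (σ·F)`
  have hFeq : rename (blockPerm (m := m) σ⁻¹) (rename (blockPerm (m := m) σ) F) = F := by
    rw [rename_rename, blockPerm_symm_comp, rename_id]
    rfl
  have hv' : v ∈ (rename (blockPerm (m := m) σ⁻¹) (rename (blockPerm (m := m) σ) F)).vars := by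
    rwa [hFeq]
  obtain ⟨w, hw, hwv⟩ := Finset.mem_image.1 (vars_rename _ _ hv')
  have hw' : w = blockPerm σ v := by
    rw [← hwv]
    obtain ⟨i, k⟩ := w
    simp
  rw [← hw', ← hvarsEq]
  exact hw

variable {𝔭 r j₀} in
/-- **Non-degeneracy** (Hodge–Pedoe X §6: "`∂f/∂ζ_ρ ≠ 0`"): for a generator `F` of `𝔭̄(r) ≠ 0` and
any block `ρ`, `Φ_{j₀}(∂F/∂u_{ρ j₀}) ≠ 0`. Indeed `F` involves `u_{ρ j₀}` (otherwise, by the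
`S_r`-symmetry, no `u_{ρ' j₀}` at all, and then `Φ(F) ≠ 0`), so `∂F/∂u_{ρj₀} ≠ 0` has smaller
`u_{ρj₀}`-degree than `F`, is not a multiple of `F`, i.e. lies outside `𝔭̄(r) = ker Φ`.
[cite: HodgePedoe1994, vol. II, Ch. X §6 (proof that `∂f/∂ζ_ρ ≠ 0`)] -/
theorem Phi_pderiv_ne_zero (hj₀ : (X j₀ : Rx m) ∉ 𝔭) {F : RU r m} (hF : Ideal.span {F} = elimIdeal 𝔭 r)
    (hne : elimIdeal 𝔭 r ≠ ⊥) (ρ : Fin r) : Phi 𝔭 r j₀ (pderiv (ρ, j₀) F) ≠ 0 := by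
  classical
  have hF0 : F ≠ 0 := by
    rintro rfl
    apply hne
    rw [← hF, Ideal.span_singleton_eq_bot]
  have hFmem : F ∈ elimIdeal 𝔭 r := by rw [← hF]; exact Ideal.mem_span_singleton_self F
  have hΦF : Phi 𝔭 r j₀ F = 0 := (mem_elimIdeal_iff_Phi 𝔭 r hj₀ F).1 hFmem
  -- `F` involves `u_{ρ j₀}`
  have hvar : (ρ, j₀) ∈ F.vars := by
    by_contra hρ
    have hall : ∀ v ∈ F.vars, v.2 ≠ j₀ := by
      rintro ⟨ρ', k⟩ hv hk
      simp only at hk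
      subst hk
      have h := blockPerm_mem_vars_of_span_eq hF (Equiv.swap ρ' ρ) hv
      simp only [blockPerm_apply, Equiv.swap_apply_left] at h
      exact hρ h
    exact Phi_ne_zero_of_forall_notMem_vars hF0 hall hΦF
  have hpd : pderiv (ρ, j₀) F ≠ 0 := pderiv_ne_zero_of_mem_vars hvar
  intro h0
  have hmem : pderiv (ρ, j₀) F ∈ elimIdeal 𝔭 r := (mem_elimIdeal_iff_Phi 𝔭 r hj₀ _).2 h0
  rw [← hF, Ideal.mem_span_singleton] at hmem
  exact not_dvd_pderiv hpd hmem

variable {𝔭 r j₀} in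
/-- **The prime is determined by its `U`-eliminant**: for a generator `F` of `𝔭̄(r) ≠ 0` and a
homogeneous `P ∈ ℚ[x̲]`, `P ∈ 𝔭 ⇔ F ∣ P(∂F/∂u_{ρ0}, …, ∂F/∂u_{ρm})` (the generic point of `V(𝔭)`
is `(∂F/∂u_{ρσ})_σ` evaluated at the generic hyperplanes through it, Hodge–Pedoe X §6 eq. (5), §7).
[cite: HodgePedoe1994, vol. II, Ch. X §7 ("factorisation of the Cayley form gives a generic point of
`V`, so no two distinct varieties can have the same Cayley form")] -/
theorem mem_iff_dvd_aeval_gradU (hj₀ : (X j₀ : Rx m) ∉ 𝔭) {F : RU r m}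
    (hF : Ideal.span {F} = elimIdeal 𝔭 r) (hne : elimIdeal 𝔭 r ≠ ⊥) (ρ : Fin r) {P : Rx m} {D : ℕ}
    (hP : P.IsHomogeneous D) : P ∈ 𝔭 ↔ F ∣ aeval (gradU r ρ F) P := by
  have hFmem : F ∈ elimIdeal 𝔭 r := by rw [← hF]; exact Ideal.mem_span_singleton_self F
  have hΦF : Phi 𝔭 r j₀ F = 0 := (mem_elimIdeal_iff_Phi 𝔭 r hj₀ F).1 hFmem
  have key := Phi_aeval_gradU hj₀ hΦF ρ hP
  have hξ : (C (ξ 𝔭 j₀) : MvPolynomial (Fin r × Fin (m + 1)) (Ω 𝔭)) ^ D ≠ 0 :=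
    pow_ne_zero _ (fun h => ξ_ne_zero hj₀ ((map_eq_zero_iff C (C_injective _ _)).1 h))
  have hd : Phi 𝔭 r j₀ (pderiv (ρ, j₀) F) ^ D ≠ 0 := pow_ne_zero _ (Phi_pderiv_ne_zero hj₀ hF hne ρ)
  rw [← aeval_ξ_eq_zero_iff 𝔭 P, ← Ideal.mem_span_singleton, hF, mem_elimIdeal_iff_Phi 𝔭 r hj₀]
  constructor
  · intro h
    rw [h, map_zero, mul_zero] at key
    exact (mul_eq_zero.1 key).resolve_left hξ
  · intro h
    rw [h, mul_zero] at key
    have := (mul_eq_zero.1 key.symm).resolve_left hd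
    exact (map_eq_zero_iff C (C_injective _ _)).1 this

/-- **"No two distinct varieties have the same Cayley form"** (Hodge–Pedoe II, Ch. X §7) in the
language of LNM 1752 Ch. 3: two homogeneous primes of `ℚ[x₀, …, x_m]` of the same dimension
`r − 1 ≥ 0` with the same `U`-eliminant ideal `𝔭̄(r)` coincide. This is hypothesis `h4` of
`NesterenkoPhilippon2001_ch3_prop_4_4_of`.
[cite: HodgePedoe1994, vol. II, Ch. X §7; NesterenkoPhilippon2001, Ch. 3 Prop. 4.4 (p. 38)] -/
theorem eq_of_elimIdeal_eq (m r : ℕ) (𝔭 𝔭' : Ideal (Rx m)) (hr : 1 ≤ r) (_hrm : r ≤ m)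
    (hhom : 𝔭.IsHomogeneous (homogeneousSubmodule (Fin (m + 1)) ℚ)) (hp : 𝔭.IsPrime)
    (hdim : ringKrullDim (Rx m ⧸ 𝔭) = r)
    (hhom' : 𝔭'.IsHomogeneous (homogeneousSubmodule (Fin (m + 1)) ℚ)) (hp' : 𝔭'.IsPrime)
    (hdim' : ringKrullDim (Rx m ⧸ 𝔭') = r)
    (h : elimIdeal 𝔭 r = elimIdeal 𝔭' r) : 𝔭 = 𝔭' := by
  classical
  haveI := hp
  haveI := hp'
  obtain ⟨F, hF⟩ := (isPrincipal_elimIdeal_of_isPrime hp hhom hr hdim).principal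
  have hF : Ideal.span {F} = elimIdeal 𝔭 r := hF.symm
  have hF' : Ideal.span {F} = elimIdeal 𝔭' r := hF.trans h
  have hne : elimIdeal 𝔭 r ≠ ⊥ := elimIdeal_ne_bot hp hhom hr hdim
  have hne' : elimIdeal 𝔭' r ≠ ⊥ := elimIdeal_ne_bot hp' hhom' hr hdim'
  obtain ⟨j₀, hj₀⟩ := exists_X_notMem (not_span_range_X_le hp.ne_top hr hdim)
  obtain ⟨j₀', hj₀'⟩ := exists_X_notMem (not_span_range_X_le hp'.ne_top hr hdim')
  let ρ : Fin r := ⟨0, hr⟩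
  -- homogeneous elements
  have hhomog : ∀ (P : Rx m) (D : ℕ), P.IsHomogeneous D → (P ∈ 𝔭 ↔ P ∈ 𝔭') := by
    intro P D hP
    rw [mem_iff_dvd_aeval_gradU hj₀ hF hne ρ hP, mem_iff_dvd_aeval_gradU hj₀' hF' hne' ρ hP]
  ext x
  rw [hhom.mem_iff, hhom'.mem_iff]
  refine forall_congr' fun i => ?_
  exact hhomog _ i (SetLike.coe_mem (DirectSum.decompose (homogeneousSubmodule (Fin (m + 1)) ℚ) x i))

end Distinct

end Nesterenko

end Literature.NumberTheory.Transcendental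

end
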